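import Literature.MathematicalPhysics.QuantumFieldTheory.Balaban1983to89.HaarDensityUnitaryGlobal
import Literature.MathematicalPhysics.QuantumLattice.GaugeGroupsUnitaryProofs

/-!
# `Balaban1983to89.ScalarUnitaryTwinBridge` — the two typings of the central circle `{z·1 : |z| = 1} ⊂ U(N)` in the
# tree are ONE: p28's `HaarDensityUnitaryGlobal.scalarUnitary` (File 2 of the global-Haar lineage) and the pre-cell
# `QuantumLattice.scalarUnitary` / `scalarUnitaryHom` / `scalarCircle` (`GaugeGroupsUnitaryProofs`)

statement-level skeleton of published theorems with citation tags; proofs where landed; nothing here is a claim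
about the Yang–Mills mass gap

Mega-formalization `lit-balaban` (HOME `run/shared/lean/pub/lit-balaban/`), unit `lit-balaban-r20` gen 38 (B12 fold
owner ∕ DEFINITIONS steward; register `lit-balaban-r20/DEFINITIONS.md` v1.35, pair H27; ruling G.5-1 «KEEP BOTH,
BRIDGE»).  Two lineages typed the same object:

* `Literature/MathematicalPhysics/QuantumLattice/GaugeGroupsUnitaryProofs` (2026-08-15; the discharge of
  `not_isSimpleCompactGroup_unitaryGroup` in the import cone of `Summits/QuantumFields/QCD/Statement.lean`):
  `scalarUnitary (z : Circle) : Matrix.unitaryGroup n ℂ := ⟨(z : ℂ) • 1, _⟩`, the homomorphism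
  `scalarUnitaryHom : Circle →* U(n)` (continuous) and its range `scalarCircle` (closed, connected, normal);
* `Balaban1983to89/HaarDensityUnitaryGlobal` (p28 gen 13, [Balaban1985UV3] p. 260 / [Helgason2000] Thm. 1.14 (13)
  globally on `U(N)`): `scalarUnitary (z : Circle) : Matrix.unitaryGroup n ℂ := ⟨(z : ℂ) • 1, _⟩` — the central
  translates `z̄·S` of the null set `S = {U : −1 ∈ σ(U)}` in the pigeonhole proof of `μ(S) = 0`.

The two definitions have the same signature and the same body (a subtype with a `Prop` field), so they are equal by
`rfl`; this file records that kernel fact and transfers the pre-cell API (homomorphism, continuity, membership in the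
centre-circle subgroup, centrality) to p28's name, so that neither lineage needs to import the other.

CITATION HEADER.  [BrockerTomDieck1985] T. Bröcker, T. tom Dieck, *Representations of Compact Lie Groups*, GTM 98,
Ch. I (1.9)–(1.10): the unitary group `U(n)`, its centre the scalar circle `{z·1 : |z| = 1}` (the source cited by the
tree's `QuantumLattice.GaugeGroups` for these objects).  [Helgason2000] S. Helgason, *Groups and Geometric Analysis*,
Ch. I §1 Thm. 1.14 (13) p. 96 (the statement File 2 serves).

WHAT IS PROVED (theorems only; 0 definitions, 0 named facts, 0 sorry): `scalarUnitary_eq` (the two objects are equal,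
`rfl`), `scalarUnitary_eq_scalarUnitaryHom`, `coe_scalarUnitary`, `continuous_scalarUnitary`,
`scalarUnitary_mem_scalarCircle`, `scalarUnitary_mul_comm` / `scalarUnitary_mem_center` (centrality), `scalarUnitary_one`,
`scalarUnitary_mul`, `scalarUnitary_inv`.

HONEST SCOPE.  A bookkeeping bridge between two accepted typings of one elementary object; nothing printed is asserted
beyond what the two files already carry.
-/

noncomputable section

namespace Literature.MathematicalPhysics.QuantumFieldTheory.Balaban1983to89.ScalarUnitaryTwinBridge

open Literature.MathematicalPhysics.QuantumLattice (scalarUnitaryHom scalarCircle scalarUnitaryHom_apply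
  continuous_scalarUnitaryHom mem_scalarCircle_iff)

variable {n : Type*} [Fintype n] [DecidableEq n]

/-- **TWIN = RECORD**: p28's `HaarDensityUnitaryGlobal.scalarUnitary z` IS the pre-cell `QuantumLattice.scalarUnitary z`
(same signature, same body). [cite: BrockerTomDieck1985, I (1.9)–(1.10)] -/
theorem scalarUnitary_eq (z : Circle) :
    (HaarDensityUnitaryGlobal.scalarUnitary z : Matrix.unitaryGroup n ℂ) = QuantumLattice.scalarUnitary z := rfl

/-- … and equals the value of the pre-cell homomorphism `scalarUnitaryHom : Circle →* U(n)`.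
[cite: BrockerTomDieck1985, I (1.9)–(1.10)] -/
theorem scalarUnitary_eq_scalarUnitaryHom (z : Circle) :
    (HaarDensityUnitaryGlobal.scalarUnitary z : Matrix.unitaryGroup n ℂ) = scalarUnitaryHom z := rfl

/-- The underlying matrix: `z • 1`. [cite: BrockerTomDieck1985, I (1.9)–(1.10)] -/
@[simp] theorem coe_scalarUnitary (z : Circle) :
    ((HaarDensityUnitaryGlobal.scalarUnitary z : Matrix.unitaryGroup n ℂ) : Matrix n n ℂ) = (z : ℂ) • (1 : Matrix n n ℂ) :=
  rfl

/-- `scalarUnitary 1 = 1`. [cite: BrockerTomDieck1985, I (1.9)–(1.10)] -/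
@[simp] theorem scalarUnitary_one : (HaarDensityUnitaryGlobal.scalarUnitary 1 : Matrix.unitaryGroup n ℂ) = 1 := by
  rw [scalarUnitary_eq_scalarUnitaryHom, map_one]

/-- `scalarUnitary (z w) = scalarUnitary z * scalarUnitary w`. [cite: BrockerTomDieck1985, I (1.9)–(1.10)] -/
theorem scalarUnitary_mul (z w : Circle) :
    (HaarDensityUnitaryGlobal.scalarUnitary (z * w) : Matrix.unitaryGroup n ℂ) =
      HaarDensityUnitaryGlobal.scalarUnitary z * HaarDensityUnitaryGlobal.scalarUnitary w := by
  simp only [scalarUnitary_eq_scalarUnitaryHom, map_mul]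

/-- `scalarUnitary z⁻¹ = (scalarUnitary z)⁻¹`. [cite: BrockerTomDieck1985, I (1.9)–(1.10)] -/
theorem scalarUnitary_inv (z : Circle) :
    (HaarDensityUnitaryGlobal.scalarUnitary z⁻¹ : Matrix.unitaryGroup n ℂ) = (HaarDensityUnitaryGlobal.scalarUnitary z)⁻¹ := by
  simp only [scalarUnitary_eq_scalarUnitaryHom, map_inv]

/-- `z ↦ z·1` is continuous into `U(N)` (transferred from `continuous_scalarUnitaryHom`).
[cite: BrockerTomDieck1985, I (1.9)–(1.10)] -/
theorem continuous_scalarUnitary :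
    Continuous (HaarDensityUnitaryGlobal.scalarUnitary : Circle → Matrix.unitaryGroup n ℂ) := by
  have h : (HaarDensityUnitaryGlobal.scalarUnitary : Circle → Matrix.unitaryGroup n ℂ) =
      fun z => scalarUnitaryHom z := funext scalarUnitary_eq_scalarUnitaryHom
  rw [h]; exact continuous_scalarUnitaryHom

/-- `z·1` lies in the pre-cell scalar-circle subgroup `scalarCircle = range scalarUnitaryHom`.
[cite: BrockerTomDieck1985, I (1.9)–(1.10)] -/
theorem scalarUnitary_mem_scalarCircle (z : Circle) :
    (HaarDensityUnitaryGlobal.scalarUnitary z : Matrix.unitaryGroup n ℂ) ∈ (scalarCircle : Subgroup (Matrix.unitaryGroup n ℂ)) :=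
  ⟨z, (scalarUnitary_eq_scalarUnitaryHom z).symm⟩

/-- The scalar unitaries are CENTRAL: `(z·1) U = U (z·1)` — the fact behind File 2's use of the translates `z̄·S` under a
left- (equivalently right-) invariant measure. [cite: BrockerTomDieck1985, I (1.9)–(1.10)] -/
theorem scalarUnitary_mul_comm (z : Circle) (U : Matrix.unitaryGroup n ℂ) :
    HaarDensityUnitaryGlobal.scalarUnitary z * U = U * HaarDensityUnitaryGlobal.scalarUnitary z := by
  apply Subtype.ext
  change ((z : ℂ) • (1 : Matrix n n ℂ)) * (U : Matrix n n ℂ) = (U : Matrix n n ℂ) * ((z : ℂ) • (1 : Matrix n n ℂ))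
  rw [Matrix.smul_mul, Matrix.mul_smul, Matrix.one_mul, Matrix.mul_one]

/-- `z·1 ∈ Z(U(N))`. [cite: BrockerTomDieck1985, I (1.9)–(1.10)] -/
theorem scalarUnitary_mem_center (z : Circle) :
    (HaarDensityUnitaryGlobal.scalarUnitary z : Matrix.unitaryGroup n ℂ) ∈ Subgroup.center (Matrix.unitaryGroup n ℂ) := by
  rw [Subgroup.mem_center_iff]
  intro U
  exact (scalarUnitary_mul_comm z U).symm

end Literature.MathematicalPhysics.QuantumFieldTheory.Balaban1983to89.ScalarUnitaryTwinBridge
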